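import Literature.MathematicalPhysics.QuantumLattice.PatchPairOperator
import Literature.MathematicalPhysics.QuantumLattice.ProjectedBCSState

/-!
# `TwTipContinuation` (stmt-HubbardSuperconductivity-1700), line `isogap-submodular-transport`,
# stub `stub_edgeOrder` — piece 3b(i): the calculus of fixed-phase BCS product states in momentum space

For real coefficient functions `u v : (ℤ/Lℤ)² → ℝ` with `u_k² + v_k² = 1` and a duplicate-free list
`l` of momenta, the (grand-canonical, fixed-phase) BCS product vector
`Ψ_l = Π_{k ∈ l} (u_k + v_k b†_k) |0⟩`, `b†_k = (pairMode k)ᴴ = c†_{k↑} c†_{−k↓}` (Bloch pair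
creators of `ReducedBCSTorus`), written with `List.prod` exactly as `ProjectedBCS.bcsState` but in
the momentum-mode vocabulary. Everything is derived from the momentum-space CAR
(`momentumAnnihilation_mul_momentumCreation`, the hard-core boson relations `pairMode_comm`,
`pairMode_commutator_conjTranspose`) and `c|0⟩ = 0`:

* the factors commute, so `Ψ_l` only depends on `l` up to permutation and
  `Ψ_l = (u_q + v_q b†_q) Ψ_{l∖q}` for `q ∈ l` (`prodState_eq_of_mem`);
* `c_{q↑} Ψ_l = 0`, `c_{−q↓} Ψ_l = 0`, `b_q Ψ_l = 0`, `n_{q↑} Ψ_l = n_{−q↓} Ψ_l = 0` for `q ∉ l`;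
* `b_q Ψ_l = v_q Ψ_{l∖q}`, `n_{q↑} Ψ_l = n_{−q↓} Ψ_l = v_q b†_q Ψ_{l∖q}` for `q ∈ l`;
* `⟨Ψ_l, Ψ_l⟩ = 1` and the two-hole overlap `⟨Ψ_{l∖p}, Ψ_{l∖q}⟩ = u_p u_q` (`p ≠ q`).

These are the textbook manipulations behind the BCS expectation values (Bardeen–Cooper–Schrieffer
1957, §II; Leggett, *Quantum Liquids* (2006) §5.4; von Delft–Ralph 2001 §4.2.3 for the hard-core
boson algebra). No definitions: the product vector is a local notation for the literal term.
-/

noncomputable section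

namespace Summit.HubbardSuperconductivity.TwTipContinuation.IsogapTransport

open Matrix Finset
open Literature.MathematicalPhysics.QuantumLattice Literature.Probability.LatticeModels
open scoped ComplexOrder ComplexConjugate

variable {L : ℕ} [NeZero L]

/-- The Bogoliubov factor `u_k + v_k b†_k` (local notation for the literal matrix term). -/
local notation "bf[" u ", " v "] " k:max =>
  (((u k : ℝ) : ℂ) • (1 : Matrix (Finset (Orb (FermionTorus 2 _))) (Finset (Orb (FermionTorus 2 _))) ℂ) +
    ((v k : ℝ) : ℂ) • (pairMode k)ᴴ)

/-- The BCS product vector `Ψ_l = Π_{k ∈ l} (u_k + v_k b†_k) |0⟩` (local notation for the literal term). -/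
local notation "Ψ[" u ", " v "] " l:max =>
  (List.prod (List.map (fun k => bf[u, v] k) l) *ᵥ (vacuum : Fock (Orb (FermionTorus 2 _))))

variable (u v : TorusSite 2 L → ℝ)

/-! ### Algebra of the factors -/

/-- `b†_k b†_{k'} = b†_{k'} b†_k` (adjoint of `pairMode_comm`). [folklore] -/
theorem pairCreator_comm (k k' : TorusSite 2 L) :
    (pairMode k)ᴴ * (pairMode k')ᴴ = (pairMode k')ᴴ * (pairMode k)ᴴ := by
  rw [← conjTranspose_mul, ← conjTranspose_mul, pairMode_comm]

/-- The Bogoliubov factors commute pairwise. [folklore] -/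
theorem commute_bf (k k' : TorusSite 2 L) : Commute (bf[u, v] k) (bf[u, v] k') := by
  refine Commute.add_left (Commute.smul_left (Commute.one_left _) _)
    (Commute.smul_left (Commute.add_right (Commute.smul_right (Commute.one_right _) _)
      (Commute.smul_right ?_ _)) _)
  exact pairCreator_comm k k'

/-- Unfolding the product vector along `k :: l`. [folklore] -/
theorem prodState_cons (k : TorusSite 2 L) (l : List (TorusSite 2 L)) :
    Ψ[u, v] (k :: l) = bf[u, v] k *ᵥ Ψ[u, v] l := by
  simp only [List.map_cons, List.prod_cons, mulVec_mulVec]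

/-- The empty product is the vacuum. [folklore] -/
theorem prodState_nil : Ψ[u, v] ([] : List (TorusSite 2 L)) = vacuum := by
  simp only [List.map_nil, List.prod_nil, one_mulVec]

/-- The product vector only depends on the list up to permutation (the factors commute). [folklore] -/
theorem prodState_perm {l l' : List (TorusSite 2 L)} (h : l.Perm l') : Ψ[u, v] l = Ψ[u, v] l' := by
  have hc : (List.map (fun k => bf[u, v] k) l).Pairwise Commute :=
    List.pairwise_map.2 (List.pairwise_of_forall fun a b => commute_bf u v a b)
  rw [(h.map _).prod_eq' hc]

/-- Peeling the factor of a momentum `q ∈ l`: `Ψ_l = (u_q + v_q b†_q) Ψ_{l∖q}`. [folklore] -/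
theorem prodState_eq_of_mem {l : List (TorusSite 2 L)} {q : TorusSite 2 L} (hq : q ∈ l) :
    Ψ[u, v] l = bf[u, v] q *ᵥ Ψ[u, v] (l.erase q) := by
  rw [prodState_perm u v (List.perm_cons_erase hq), prodState_cons]

/-! ### CAR bookkeeping in momentum space -/

omit [NeZero L] in
/-- `⟨x, Aᴴ y⟩ = ⟨A x, y⟩` in `dotProduct` form. [folklore] -/
theorem star_dotProduct_conjTranspose_mulVec {n : Type*} [Fintype n] (A : Matrix n n ℂ)
    (x y : n → ℂ) : star x ⬝ᵥ (Aᴴ *ᵥ y) = star (A *ᵥ x) ⬝ᵥ y := by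
  rw [star_mulVec, dotProduct_mulVec]

/-- `c_{kσ} |0⟩ = 0` for the Bloch modes. [folklore] -/
theorem momentumAnnihilation_mulVec_vacuum (k : TorusSite 2 L) (σ : Fin 2) :
    momentumAnnihilation k σ *ᵥ (vacuum : Fock (Orb (FermionTorus 2 L))) = 0 := by
  unfold momentumAnnihilation
  rw [sum_mulVec]
  refine Finset.sum_eq_zero fun x _ => ?_
  rw [smul_mulVec, annihilation_mulVec_vacuum_holds, smul_zero]

omit [NeZero L] in
/-- `⟨0|0⟩ = 1`. [folklore] -/
theorem star_vacuum_dotProduct_vacuum :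
    star (vacuum : Fock (Orb (FermionTorus 2 L))) ⬝ᵥ vacuum = 1 := by
  simp [vacuum, dotProduct, Pi.single_apply]

/-- `c_{q↑} b†_k = b†_k c_{q↑} + δ_{qk} c†_{−k↓}`. [folklore] -/
theorem momentumAnnihilation_up_mul_pairCreator (q k : TorusSite 2 L) :
    momentumAnnihilation q 0 * (pairMode k)ᴴ =
      (pairMode k)ᴴ * momentumAnnihilation q 0 + (if q = k then momentumCreation (-k) 1 else 0) := by
  rw [pairMode_conjTranspose, ← Matrix.mul_assoc, momentumAnnihilation_mul_momentumCreation, sub_mul,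
    Matrix.mul_assoc, momentumAnnihilation_mul_momentumCreation]
  have h01 : ¬ (q = -k ∧ (0 : Fin 2) = 1) := fun h => absurd h.2 (by decide)
  rw [if_neg h01, zero_sub, mul_neg, sub_neg_eq_add, ← Matrix.mul_assoc, add_comm]
  congr 1
  by_cases hqk : q = k
  · rw [if_pos ⟨hqk, rfl⟩, if_pos hqk, Matrix.one_mul]
  · rw [if_neg (fun h => hqk h.1), if_neg hqk, Matrix.zero_mul]

/-- `c_{q↓} b†_k = b†_k c_{q↓} − δ_{q,−k} c†_{k↑}`. [folklore] -/
theorem momentumAnnihilation_down_mul_pairCreator (q k : TorusSite 2 L) :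
    momentumAnnihilation q 1 * (pairMode k)ᴴ =
      (pairMode k)ᴴ * momentumAnnihilation q 1 - (if q = -k then momentumCreation k 0 else 0) := by
  rw [pairMode_conjTranspose, ← Matrix.mul_assoc, momentumAnnihilation_mul_momentumCreation]
  have h10 : ¬ (q = k ∧ (1 : Fin 2) = 0) := fun h => absurd h.2 (by decide)
  rw [if_neg h10, zero_sub, neg_mul, Matrix.mul_assoc, momentumAnnihilation_mul_momentumCreation,
    mul_sub, ← Matrix.mul_assoc, neg_sub, sub_eq_neg_add]
  by_cases hqk : q = -k
  · rw [if_pos ⟨hqk, rfl⟩, if_pos hqk, Matrix.mul_one]; abel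
  · rw [if_neg (fun h => hqk h.1), if_neg hqk, Matrix.mul_zero]; abel

/-- `n_{kσ} c†_{kσ} = c†_{kσ}` (Pauli). [folklore] -/
theorem momentumNumber_mul_momentumCreation_self (k : TorusSite 2 L) (σ : Fin 2) :
    momentumNumber k σ * momentumCreation k σ = momentumCreation k σ := by
  rw [momentumNumber, Matrix.mul_assoc, momentumAnnihilation_mul_momentumCreation, if_pos ⟨rfl, rfl⟩,
    mul_sub, Matrix.mul_one, ← Matrix.mul_assoc, momentumCreation_mul_self, Matrix.zero_mul, sub_zero]

/-- `n_{kσ} c†_{k'σ'} = c†_{k'σ'} n_{kσ}` for different modes. [folklore] -/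
theorem momentumNumber_mul_momentumCreation_of_ne {k k' : TorusSite 2 L} {σ σ' : Fin 2}
    (h : ¬ (k = k' ∧ σ = σ')) :
    momentumNumber k σ * momentumCreation k' σ' = momentumCreation k' σ' * momentumNumber k σ := by
  rw [momentumNumber, Matrix.mul_assoc, momentumAnnihilation_mul_momentumCreation, if_neg h, zero_sub,
    mul_neg, ← Matrix.mul_assoc, momentumCreation_mul_eq_neg k k' σ σ', neg_mul, neg_neg, Matrix.mul_assoc]

/-- `n_{q↑} b†_q = b†_q`. [folklore] -/
theorem momentumNumber_up_mul_pairCreator (q : TorusSite 2 L) :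
    momentumNumber q 0 * (pairMode q)ᴴ = (pairMode q)ᴴ := by
  rw [pairMode_conjTranspose, ← Matrix.mul_assoc, momentumNumber_mul_momentumCreation_self]

/-- `n_{−q↓} b†_q = b†_q`. [folklore] -/
theorem momentumNumber_down_mul_pairCreator (q : TorusSite 2 L) :
    momentumNumber (-q) 1 * (pairMode q)ᴴ = (pairMode q)ᴴ := by
  have h : ¬ (-q = q ∧ (1 : Fin 2) = 0) := fun h => absurd h.2 (by decide)
  rw [pairMode_conjTranspose, ← Matrix.mul_assoc, momentumNumber_mul_momentumCreation_of_ne h,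
    Matrix.mul_assoc, momentumNumber_mul_momentumCreation_self]

/-! ### Annihilators of the product vector -/

/-- `c_{q↑} Ψ_l = 0` for `q ∉ l`. [folklore] -/
theorem momentumAnnihilation_up_prodState_of_not_mem {l : List (TorusSite 2 L)} {q : TorusSite 2 L}
    (hq : q ∉ l) : momentumAnnihilation q 0 *ᵥ Ψ[u, v] l = 0 := by
  induction l with
  | nil => rw [prodState_nil, momentumAnnihilation_mulVec_vacuum]
  | cons k l ih =>
    have hqk : q ≠ k := fun h => hq (h ▸ List.mem_cons_self)
    have hql : q ∉ l := fun h => hq (List.mem_cons_of_mem _ h)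
    rw [prodState_cons, mulVec_mulVec, mul_add, mul_smul_comm, mul_smul_comm, Matrix.mul_one,
      momentumAnnihilation_up_mul_pairCreator, if_neg hqk, add_zero, add_mulVec, smul_mulVec,
      smul_mulVec, ← mulVec_mulVec, ih hql, mulVec_zero, smul_zero, smul_zero, add_zero]

/-- `c_{q↓} Ψ_l = 0` for `−q ∉ l`. [folklore] -/
theorem momentumAnnihilation_down_prodState_of_not_mem {l : List (TorusSite 2 L)} {q : TorusSite 2 L}
    (hq : -q ∉ l) : momentumAnnihilation q 1 *ᵥ Ψ[u, v] l = 0 := by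
  induction l with
  | nil => rw [prodState_nil, momentumAnnihilation_mulVec_vacuum]
  | cons k l ih =>
    have hqk : q ≠ -k := fun h => hq (by rw [h, neg_neg]; exact List.mem_cons_self)
    have hql : -q ∉ l := fun h => hq (List.mem_cons_of_mem _ h)
    rw [prodState_cons, mulVec_mulVec, mul_add, mul_smul_comm, mul_smul_comm, Matrix.mul_one,
      momentumAnnihilation_down_mul_pairCreator, if_neg hqk, sub_zero, add_mulVec, smul_mulVec,
      smul_mulVec, ← mulVec_mulVec, ih hql, mulVec_zero, smul_zero, smul_zero, add_zero]

/-- `b_q Ψ_l = 0` for `q ∉ l`. [folklore] -/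
theorem pairMode_prodState_of_not_mem {l : List (TorusSite 2 L)} {q : TorusSite 2 L} (hq : q ∉ l) :
    pairMode q *ᵥ Ψ[u, v] l = 0 := by
  rw [pairMode, ← mulVec_mulVec, momentumAnnihilation_up_prodState_of_not_mem u v hq, mulVec_zero]

/-- `n_{q↑} Ψ_l = 0` for `q ∉ l`. [folklore] -/
theorem momentumNumber_up_prodState_of_not_mem {l : List (TorusSite 2 L)} {q : TorusSite 2 L}
    (hq : q ∉ l) : momentumNumber q 0 *ᵥ Ψ[u, v] l = 0 := by
  rw [momentumNumber, ← mulVec_mulVec, momentumAnnihilation_up_prodState_of_not_mem u v hq, mulVec_zero]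

/-- `n_{−q↓} Ψ_l = 0` for `q ∉ l`. [folklore] -/
theorem momentumNumber_down_prodState_of_not_mem {l : List (TorusSite 2 L)} {q : TorusSite 2 L}
    (hq : q ∉ l) : momentumNumber (-q) 1 *ᵥ Ψ[u, v] l = 0 := by
  rw [momentumNumber, ← mulVec_mulVec,
    momentumAnnihilation_down_prodState_of_not_mem u v (q := -q) (by rwa [neg_neg]), mulVec_zero]

/-- `b_q b†_q Ψ_l = Ψ_l` for `q ∉ l` (hard-core boson commutator on a level without the pair `q`). [folklore] -/
theorem pairMode_pairCreator_prodState_of_not_mem {l : List (TorusSite 2 L)} {q : TorusSite 2 L}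
    (hq : q ∉ l) : pairMode q *ᵥ ((pairMode q)ᴴ *ᵥ Ψ[u, v] l) = Ψ[u, v] l := by
  have h := pairMode_commutator_conjTranspose q q
  rw [if_pos rfl, sub_eq_iff_eq_add] at h
  rw [mulVec_mulVec, h, add_mulVec, sub_mulVec, sub_mulVec, one_mulVec, ← mulVec_mulVec,
    pairMode_prodState_of_not_mem u v hq, mulVec_zero, add_zero,
    momentumNumber_up_prodState_of_not_mem u v hq, momentumNumber_down_prodState_of_not_mem u v hq,
    sub_zero, sub_zero]

/-! ### Action on a level carrying a factor -/

/-- `b_q Ψ_l = v_q Ψ_{l∖q}` for `q ∈ l`. [folklore] -/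
theorem pairMode_prodState_of_mem {l : List (TorusSite 2 L)} (hl : l.Nodup) {q : TorusSite 2 L}
    (hq : q ∈ l) : pairMode q *ᵥ Ψ[u, v] l = ((v q : ℝ) : ℂ) • Ψ[u, v] (l.erase q) := by
  have hq' : q ∉ l.erase q := hl.not_mem_erase
  rw [prodState_eq_of_mem u v hq, mulVec_mulVec, mul_add, mul_smul_comm, mul_smul_comm, Matrix.mul_one,
    add_mulVec, smul_mulVec, smul_mulVec, pairMode_prodState_of_not_mem u v hq', smul_zero,
    zero_add, ← mulVec_mulVec, pairMode_pairCreator_prodState_of_not_mem u v hq']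

/-- `n_{q↑} Ψ_l = v_q b†_q Ψ_{l∖q}` for `q ∈ l`. [folklore] -/
theorem momentumNumber_up_prodState_of_mem {l : List (TorusSite 2 L)} (hl : l.Nodup) {q : TorusSite 2 L}
    (hq : q ∈ l) :
    momentumNumber q 0 *ᵥ Ψ[u, v] l = ((v q : ℝ) : ℂ) • ((pairMode q)ᴴ *ᵥ Ψ[u, v] (l.erase q)) := by
  have hq' : q ∉ l.erase q := hl.not_mem_erase
  rw [prodState_eq_of_mem u v hq, mulVec_mulVec, mul_add, mul_smul_comm, mul_smul_comm, Matrix.mul_one,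
    momentumNumber_up_mul_pairCreator, add_mulVec, smul_mulVec, smul_mulVec,
    momentumNumber_up_prodState_of_not_mem u v hq', smul_zero, zero_add]

/-- `n_{−q↓} Ψ_l = v_q b†_q Ψ_{l∖q}` for `q ∈ l`. [folklore] -/
theorem momentumNumber_down_prodState_of_mem {l : List (TorusSite 2 L)} (hl : l.Nodup)
    {q : TorusSite 2 L} (hq : q ∈ l) :
    momentumNumber (-q) 1 *ᵥ Ψ[u, v] l = ((v q : ℝ) : ℂ) • ((pairMode q)ᴴ *ᵥ Ψ[u, v] (l.erase q)) := by
  have hq' : q ∉ l.erase q := hl.not_mem_erase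
  rw [prodState_eq_of_mem u v hq, mulVec_mulVec, mul_add, mul_smul_comm, mul_smul_comm, Matrix.mul_one,
    momentumNumber_down_mul_pairCreator, add_mulVec, smul_mulVec, smul_mulVec,
    momentumNumber_down_prodState_of_not_mem u v hq', smul_zero, zero_add]

/-! ### Norms and overlaps (normalised factors `u_k² + v_k² = 1`) -/

/-- `⟨Ψ_l, b†_q Ψ_l⟩ = 0` for `q ∉ l`. [folklore] -/
theorem star_prodState_dotProduct_pairCreator_prodState {l : List (TorusSite 2 L)} {q : TorusSite 2 L}
    (hq : q ∉ l) : star (Ψ[u, v] l) ⬝ᵥ ((pairMode q)ᴴ *ᵥ Ψ[u, v] l) = 0 := by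
  rw [star_dotProduct_conjTranspose_mulVec, pairMode_prodState_of_not_mem u v hq, star_zero, zero_dotProduct]

/-- `⟨b†_q Ψ_l, Ψ_l⟩ = 0` for `q ∉ l`. [folklore] -/
theorem star_pairCreator_prodState_dotProduct_prodState {l : List (TorusSite 2 L)} {q : TorusSite 2 L}
    (hq : q ∉ l) : star ((pairMode q)ᴴ *ᵥ Ψ[u, v] l) ⬝ᵥ Ψ[u, v] l = 0 := by
  have h := star_dotProduct_conjTranspose_mulVec (pairMode q)ᴴ (Ψ[u, v] l) (Ψ[u, v] l)
  rw [conjTranspose_conjTranspose] at h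
  rw [← h, pairMode_prodState_of_not_mem u v hq, dotProduct_zero]

/-- Action of a factor: `(u_k + v_k b†_k) x = u_k x + v_k b†_k x`. [folklore] -/
theorem bf_mulVec (k : TorusSite 2 L) (x : Fock (Orb (FermionTorus 2 L))) :
    bf[u, v] k *ᵥ x = ((u k : ℝ) : ℂ) • x + ((v k : ℝ) : ℂ) • ((pairMode k)ᴴ *ᵥ x) := by
  rw [add_mulVec, smul_mulVec, smul_mulVec, one_mulVec]

/-- Sesquilinear expansion of `⟨(u_p + v_p b†_p) x, (u_q + v_q b†_q) y⟩` (real coefficients). [folklore] -/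
theorem star_bf_mulVec_dotProduct_bf_mulVec (p q : TorusSite 2 L) (x y : Fock (Orb (FermionTorus 2 L))) :
    star (bf[u, v] p *ᵥ x) ⬝ᵥ (bf[u, v] q *ᵥ y) =
      ((u p : ℝ) : ℂ) * ((u q : ℝ) : ℂ) * (star x ⬝ᵥ y) +
        ((u p : ℝ) : ℂ) * ((v q : ℝ) : ℂ) * (star x ⬝ᵥ ((pairMode q)ᴴ *ᵥ y)) +
        ((v p : ℝ) : ℂ) * ((u q : ℝ) : ℂ) * (star ((pairMode p)ᴴ *ᵥ x) ⬝ᵥ y) +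
        ((v p : ℝ) : ℂ) * ((v q : ℝ) : ℂ) * (star ((pairMode p)ᴴ *ᵥ x) ⬝ᵥ ((pairMode q)ᴴ *ᵥ y)) := by
  rw [bf_mulVec, bf_mulVec, star_add, star_smul, star_smul, add_dotProduct, smul_dotProduct, smul_dotProduct,
    dotProduct_add, dotProduct_add, dotProduct_smul, dotProduct_smul, dotProduct_smul, dotProduct_smul]
  simp only [Complex.star_def, Complex.conj_ofReal, smul_eq_mul]
  ring

/-- `⟨b†_q x, b†_p y⟩ = ⟨x, b_q b†_p y⟩`. [folklore] -/
theorem star_pairCreator_mulVec_dotProduct (p q : TorusSite 2 L) (x y : Fock (Orb (FermionTorus 2 L))) :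
    star ((pairMode q)ᴴ *ᵥ x) ⬝ᵥ ((pairMode p)ᴴ *ᵥ y) = star x ⬝ᵥ (pairMode q *ᵥ ((pairMode p)ᴴ *ᵥ y)) := by
  have h := star_dotProduct_conjTranspose_mulVec (pairMode q)ᴴ x ((pairMode p)ᴴ *ᵥ y)
  rw [conjTranspose_conjTranspose] at h
  exact h.symm

/-- **Normalisation**: `⟨Ψ_l, Ψ_l⟩ = 1` for a duplicate-free `l` and normalised factors
`u_k² + v_k² = 1`. [folklore] -/
theorem star_prodState_dotProduct_self (huv : ∀ k, u k ^ 2 + v k ^ 2 = 1) {l : List (TorusSite 2 L)}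
    (hl : l.Nodup) : star (Ψ[u, v] l) ⬝ᵥ Ψ[u, v] l = 1 := by
  induction l with
  | nil => rw [prodState_nil, star_vacuum_dotProduct_vacuum]
  | cons k l ih =>
    obtain ⟨hk, hl'⟩ := List.nodup_cons.1 hl
    rw [prodState_cons, star_bf_mulVec_dotProduct_bf_mulVec, ih hl',
      star_prodState_dotProduct_pairCreator_prodState u v hk,
      star_pairCreator_prodState_dotProduct_prodState u v hk, star_pairCreator_mulVec_dotProduct,
      pairMode_pairCreator_prodState_of_not_mem u v hk, ih hl']
    have h := huv k
    have h' : ((u k : ℝ) : ℂ) * ((u k : ℝ) : ℂ) + ((v k : ℝ) : ℂ) * ((v k : ℝ) : ℂ) = 1 := by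
      rw [← Complex.ofReal_mul, ← Complex.ofReal_mul, ← Complex.ofReal_add, ← Complex.ofReal_one,
        Complex.ofReal_inj]
      nlinarith
    linear_combination h'

/-- **Two-hole overlap**: `⟨Ψ_{l∖p}, Ψ_{l∖q}⟩ = u_p u_q` for distinct `p, q ∈ l` (`l` duplicate-free,
normalised factors). [folklore] -/
theorem star_prodState_erase_dotProduct_prodState_erase (huv : ∀ k, u k ^ 2 + v k ^ 2 = 1)
    {l : List (TorusSite 2 L)} (hl : l.Nodup) {p q : TorusSite 2 L} (hp : p ∈ l) (hq : q ∈ l)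
    (hpq : p ≠ q) :
    star (Ψ[u, v] (l.erase p)) ⬝ᵥ Ψ[u, v] (l.erase q) = ((u p : ℝ) : ℂ) * ((u q : ℝ) : ℂ) := by
  have hqp : q ∈ l.erase p := (List.mem_erase_of_ne hpq.symm).2 hq
  have hpq' : p ∈ l.erase q := (List.mem_erase_of_ne hpq).2 hp
  have hm : ((l.erase p).erase q).Nodup := (hl.erase p).erase q
  have hpm : p ∉ (l.erase p).erase q := fun h => hl.not_mem_erase (List.mem_of_mem_erase h)
  have hqm : q ∉ (l.erase p).erase q := (hl.erase p).not_mem_erase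
  rw [prodState_eq_of_mem u v hqp, prodState_eq_of_mem u v hpq', ← List.erase_comm p q,
    star_bf_mulVec_dotProduct_bf_mulVec, star_prodState_dotProduct_self u v huv hm,
    star_prodState_dotProduct_pairCreator_prodState u v hpm,
    star_pairCreator_prodState_dotProduct_prodState u v hqm, star_pairCreator_mulVec_dotProduct,
    mulVec_mulVec]
  have hcomm : pairMode q * (pairMode p)ᴴ = (pairMode p)ᴴ * pairMode q := by
    have h := pairMode_commutator_conjTranspose q p
    rw [if_neg hpq.symm, sub_eq_zero] at h
    exact h
  rw [hcomm, ← mulVec_mulVec, pairMode_prodState_of_not_mem u v hqm, mulVec_zero, dotProduct_zero]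
  ring

/-- **Normalisation of the BCS product vector (piece 3b(i) of `stub_edgeOrder`)**, spelled out on
the literal term: for `u_k² + v_k² = 1` and a duplicate-free list `l` of momenta,
`⟨Π_{k∈l}(u_k + v_k b†_k)|0⟩, Π_{k∈l}(u_k + v_k b†_k)|0⟩⟩ = 1`. Bardeen–Cooper–Schrieffer 1957 §II. [folklore] -/
theorem bcsProductState_norm_eq_one :
    ∀ (L : ℕ) [NeZero L] (u v : TorusSite 2 L → ℝ), (∀ k, u k ^ 2 + v k ^ 2 = 1) → ∀ (l : List (TorusSite 2 L)), l.Nodup → star ((List.map (fun k => ((u k : ℝ) : ℂ) • (1 : Matrix (Finset (Orb (FermionTorus 2 L))) (Finset (Orb (FermionTorus 2 L))) ℂ) + ((v k : ℝ) : ℂ) • (pairMode k)ᴴ) l).prod *ᵥ (vacuum : Fock (Orb (FermionTorus 2 L)))) ⬝ᵥ ((List.map (fun k => ((u k : ℝ) : ℂ) • (1 : Matrix (Finset (Orb (FermionTorus 2 L))) (Finset (Orb (FermionTorus 2 L))) ℂ) + ((v k : ℝ) : ℂ) • (pairMode k)ᴴ) l).prod *ᵥ (vacuum : Fock (Orb (FermionTorus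 2 L)))) = 1 :=
  fun _ _ u v huv _ hl => star_prodState_dotProduct_self u v huv hl

end Summit.HubbardSuperconductivity.TwTipContinuation.IsogapTransport
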